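import Summits.CriticalPhenomena.PercolationContinuityZ3.Theorems.TallClusterMassBound.Negative.FalseWithoutCriticality
import Summits.CriticalPhenomena.PercolationContinuityZ3.Theorems.BoundaryTwoArmDecay.Negative.LoadBearing
import Summits.CriticalPhenomena.PercolationContinuityZ3.Theorems.PercLowPointHalfSpaceAssemblyReduction
import Literature.Probability.Percolation.TwoPointFunction

/-!
# Disproof of `LowPointBookkeeping` (crux K, stmt-CriticalPhenomena-14713) — findings

Standing disprover's work file (refuter cdisprove seat, cycle 1, 2026-08-16).  `sorry`-free unless a
docstring says NEAR-MISS.  Nothing here asserts a route statement positively.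

K := `BoundaryTwoArmDecay → TallClusterMassBound → QuantitativeBGN → [τ_{p_c}(0, n e₀) → 0]`
(A → B → C → axis decay).  Findings, indexed:

* §0 `BookkeepingAt p` — K as the point `p = p_c(ℤ³)` of a one-parameter family (`Iff.rfl`).
* §1 LOGICAL STATUS (why K resists every disproof): the conclusion of K is EQUIVALENT to the conjunct
  `θ(p_c(ℤ³)) = 0` (`axisDecayAt_criticalProbI_iff`), hence `K ↔ Assembly` (stmt-0915) and
  `¬K ↔ A ∧ B ∧ C ∧ θ(p_c) > 0` (`not_lowPointBookkeeping_iff`): an unconditional refutation of K is a proof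
  that the percolation transition of `ℤ³` is DISCONTINUOUS (plus A, B, C).  Conversely K follows from the
  conjunct alone, so K carries no information beyond "A ∧ B ∧ C ⇒ conjunct"; only a proof THROUGH the
  bush/floor bookkeeping is informative (planner's own reading; kernel-checked here).
* §2 LOAD-BEARING ANALYSIS at family level: at `p = 1` hypothesis A holds (`twoArmAt_one`: adjacent roots are
  joined, the disjoint two-arm event is null) while the conclusion FAILS (`not_axisDecayAt_one`: `τ_1 ≡ 1`), and
  B, C both fail (`tallClusterMassBound_false_without_criticality`, `not_armDecayAt_one`).  Hence
  `bookkeeping_false_without_BC`: no argument valid for every `p` derives the conclusion from A alone — any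
  proof of K must use B or C quantitatively (heuristically B: by the saturation argument A and C are
  consistent with a jump world, B is not).  Neither "K without B" nor "K without C" is refutable inside the
  family `(P_p)` (wherever the conclusion fails, both B and C fail), and at `p_c` itself nothing is refutable
  short of `θ(p_c) > 0`.  §2b: at `p = 0` A, B, C AND the conclusion all hold (`bookkeepingAt_zero`), so the
  family is non-degenerate at both ends (the SHAPES of A, B, C are jointly satisfiable).
* §3 NATURAL STRENGTHENINGS / PROPOSED STUBS REFUTED AS TYPED (crux idea cards, `Cruxes/…/SketchIdeator{1,2}.lean`):
  `not_noFatHalfBox`, `not_noFatHalfBoxWindows` (card holder-tightness-decoupling, B♯: at `r = 1` every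
  cluster is "fat", `1 = r^{11/4+δ} ≤ |{0}|`; repair: threshold `C·r^{11/4+δ}` with `C > 27` or `r ≥ 2`);
  `floorDilute_empty_iff_false_without_lattice` (card floor-density-russo-pair-overlap, endpoint `s = 0`:
  false for configurations with non-lattice bonds; repair: add `ω ⊆ (zdGraph 3).edgeSet`, true a.s.).
* §4 EXPONENT LEDGER of the intended mechanism: the dyadic series `Σ_k 2^{k(2m-3-a₂)}` converges iff
  `a₂ > 2m - 3`; at the typed values `m = 11/4`, `a₂ = 5/2 + κ` the margin is exactly `κ`
  (`bookkeepingSeries_summable_iff`, `not_summable_bookkeepingSeries_kappa_zero`) — A's `0 < κ` is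
  load-bearing for the MECHANISM even though (§2) nothing at `p_c` can show it load-bearing for the TRUTH of K.
* §5 WHY IT RESISTS (docstring census): no rigorous polynomial LOWER bound is known for any disjoint
  boundary two-arm event in `d = 3` (disjointness is decreasing; forcing it costs a closed surface,
  `e^{-c r²}`), so A, A_poly, A♯, (AB), (AB₂), (DR) are all irrefutable today; B's and C's refutable windows
  are those of their own Negative files (`m < 1`, `a > 2`).
-/

noncomputable section

open MeasureTheory ProbabilityTheory Filter Topology
open Literature.Probability.Percolation Literature.Probability.LatticeModels
open Summit.CriticalPhenomena.PercolationContinuityZ3.Theses.PercLowPointHalfSpace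
open Summit.CriticalPhenomena.PercolationContinuityZ3.Theorems
open Summit.CriticalPhenomena.PercolationContinuityZ3.Theorems.TallClusterMassBound.Negative
  (V3 Hs Pp conn arm mass armProb MassBoundAt column column_subset_edgeSet reachable_up_of_column up
    setOf_column_subset_arm zero_mem_Hs mem_conn_iff not_forall_rpow_le
    tallClusterMassBound_false_without_criticality conn_zero snorm mem_arm_iff measurableSet_arm)
open Summit.CriticalPhenomena.PercolationContinuityZ3.Theorems.BoundaryTwoArmDecay.Negative
  (E H e adj_zero_e e_ne_zero e_mem_H)

namespace Summit.CriticalPhenomena.PercolationContinuityZ3.Cruxes.LowPointBookkeeping.Disproof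

/-! ## §0 The family `BookkeepingAt p` and the crux as its point `p_c` -/

/-- `AxisDecayAt p`: `P_p(0 ↔ n e₀) → 0` along the normal axis (the conclusion of K at parameter `p`). -/
def AxisDecayAt (p : unitInterval) : Prop :=
  Tendsto (fun n : ℕ => (Pp p).real (openConn (0 : V3) (Pi.single 0 (n : ℤ) : V3))) atTop (𝓝 0)

/-- `TwoArmAt p`: hypothesis A (`BoundaryTwoArmDecay`) at parameter `p`, through the verbatim event
`E r` of `BoundaryTwoArmDecay.Negative.LoadBearing`. -/
def TwoArmAt (p : unitInterval) : Prop :=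
  ∃ κ C : ℝ, 0 < κ ∧ ∀ r : ℕ, 1 ≤ r → (Pp p).real (E r) ≤ C * (r : ℝ) ^ (-(5 / 2 + κ))

/-- `ArmDecayAt p`: hypothesis C (`QuantitativeBGN`) at parameter `p`. -/
def ArmDecayAt (p : unitInterval) : Prop :=
  ∃ a C : ℝ, 0 < a ∧ ∀ r : ℕ, 1 ≤ r → armProb p r ≤ C * (r : ℝ) ^ (-a)

/-- `BookkeepingAt p`: the crux K with `p_c(ℤ³)` replaced by `p` (B is `MassBoundAt p (11/4)` of
`TallClusterMassBound.Negative.MassExponentFamily`). -/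
def BookkeepingAt (p : unitInterval) : Prop :=
  TwoArmAt p → MassBoundAt p ((11 : ℝ) / 4) → ArmDecayAt p → AxisDecayAt p

/-- The crux, verbatim, is `BookkeepingAt p_c` (definitional). -/
theorem lowPointBookkeeping_iff_bookkeepingAt :
    LowPointBookkeeping ↔ BookkeepingAt (criticalProbI 3) := Iff.rfl

/-- The conclusion of K is `τ_{p_c}(0, n e₀) → 0` in the tree's two-point notation (definitional). -/
theorem axisDecayAt_iff_tau (p : unitInterval) :
    AxisDecayAt p ↔ Tendsto (fun n : ℕ => tau 3 p 0 (Pi.single 0 (n : ℤ))) atTop (𝓝 0) := Iff.rfl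

/-! ## §1 Logical status: the conclusion of K is the conjunct; `¬K ⟺ A ∧ B ∧ C ∧ θ(p_c) > 0` -/

/-- **The conclusion of K alone is equivalent to `θ(p_c(ℤ³)) = 0`.**  (→) `θ² ≤ τ` along the axis
(`LowPoint.percolationContinuityZ3_of_tendsto_openConn`); (←) `τ_{p_c}(0,·) → 0` cofinitely when
`θ(p_c) = 0` (`tendsto_tau_cofinite_of_theta_eq_zero`, a.s. finiteness of `C(0)`), restricted to the
injective axis `n ↦ n e₀`. -/
theorem axisDecayAt_criticalProbI_iff :
    AxisDecayAt (criticalProbI 3) ↔ _root_.PercolationContinuityZ3 := by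
  constructor
  · intro h
    exact LowPoint.percolationContinuityZ3_of_tendsto_openConn (fun n : ℕ => (Pi.single 0 (n : ℤ) : V3)) h
  · intro h
    have hτ : Tendsto (tau 3 (criticalProbI 3) 0) cofinite (𝓝 0) :=
      Literature.Barriers.CriticalPhenomena.tendsto_tau_cofinite_of_theta_eq_zero (criticalProbI 3) h
    have hinj : Function.Injective (fun n : ℕ => (Pi.single 0 (n : ℤ) : V3)) := by
      intro m n hmn
      have h0 := congrFun hmn 0
      simp only [Pi.single_eq_same, Nat.cast_inj] at h0
      exact h0
    have h1 := hτ.comp hinj.tendsto_cofinite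
    rw [Nat.cofinite_eq_atTop] at h1
    exact h1

/-- **K ⟺ Assembly (stmt-CriticalPhenomena-0915).**  K is the route's assembly with the proved low-point
identity, floor split and floor case folded in; as a STATEMENT it is neither weaker nor stronger. -/
theorem lowPointBookkeeping_iff_assembly : LowPointBookkeeping ↔ Assembly := by
  unfold LowPointBookkeeping Assembly
  exact imp_congr_right fun _ => imp_congr_right fun _ => imp_congr_right fun _ =>
    axisDecayAt_criticalProbI_iff

/-- **Refuting K means proving a discontinuous transition on `ℤ³`.**  `¬K` holds iff A, B, C all hold AND
`θ(p_c(ℤ³)) > 0` (`¬ PercolationContinuityZ3`).  This is why no counterexample search, degenerate case or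
small model can touch K itself: its only free content is the conjunct. -/
theorem not_lowPointBookkeeping_iff :
    ¬ LowPointBookkeeping ↔
      BoundaryTwoArmDecay ∧ TallClusterMassBound ∧ QuantitativeBGN ∧ ¬ _root_.PercolationContinuityZ3 := by
  rw [lowPointBookkeeping_iff_assembly]
  unfold Assembly
  simp only [Classical.not_imp]
  exact Iff.rfl

/-- The conjunct alone gives K (so K is "true for free" in the real world if `θ(p_c) = 0`, and a proof of K
that does not pass through A, B, C is a proof of the conjunct).  Stated as a non-implication of the
NEGATIVE lane: `¬K` is impossible under the conjunct. -/
theorem not_not_lowPointBookkeeping_of_continuity (h : _root_.PercolationContinuityZ3) :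
    ¬ ¬ LowPointBookkeeping := by
  rw [not_lowPointBookkeeping_iff]
  exact fun hK => hK.2.2.2 h

/-! ## §2 Load-bearing analysis in the family `p ↦ BookkeepingAt p`: the point `p = 1` -/

/-- `P_1` is the point mass at the full lattice configuration. -/
theorem Pp_one : Pp 1 = Measure.dirac (zdGraph 3).edgeSet := by
  unfold Pp bondPercolation
  exact setBernoulli_one _

/-- The full lattice configuration joins `0` to `e = (0,1,0)` inside `ℍ` (one open lattice step). -/
theorem edgeSet_mem_openConnIn_e : (zdGraph 3).edgeSet ∈ openConnIn H (0 : Site 3) e := by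
  have h : (zdGraph 3).edgeSet ∈ conn e := by
    rw [mem_conn_iff]
    refine SimpleGraph.Adj.reachable ?_
    rw [SimpleGraph.inf_adj, openGraph_adj, withinGraph_adj, SimpleGraph.top_adj]
    exact ⟨⟨(SimpleGraph.mem_edgeSet _).2 adj_zero_e, e_ne_zero.symm⟩, e_ne_zero.symm, zero_mem_Hs, e_mem_H⟩
  exact h

/-- At `p = 1` the disjoint two-arm event is NULL: `P_1(E r) = 0` for every `r` (the roots `0 ∼ e` are
joined by their open edge, so `0 ↮_ℍ e` fails a.s.). -/
theorem real_E_one (r : ℕ) : (Pp 1).real (E r) = 0 := by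
  have hsub : E r ⊆ (openConnIn H (0 : Site 3) e)ᶜ := fun ω hω => hω.2.2
  have h0 : (Pp 1).real (openConnIn H (0 : Site 3) e)ᶜ = 0 := by
    rw [measureReal_def, Pp_one,
      Measure.dirac_apply' _ (measurableSet_openConnIn_of_countable _ _ _).compl]
    simp [Set.indicator_of_notMem, edgeSet_mem_openConnIn_e]
  exact le_antisymm ((measureReal_mono hsub).trans h0.le) measureReal_nonneg

/-- **A holds at `p = 1`** (with `κ = 1`, `C = 0`). -/
theorem twoArmAt_one : TwoArmAt 1 :=
  ⟨1, 0, one_pos, fun r _ => by rw [real_E_one, zero_mul]⟩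

/-- At `p = 1`, `P_1(0 ↔ n e₀) = 1` for every `n` (the open column). -/
theorem real_openConn_axis_one (n : ℕ) :
    (Pp 1).real (openConn (0 : V3) (Pi.single 0 (n : ℤ) : V3)) = 1 := by
  apply le_antisymm measureReal_le_one
  have h := bondPercolation_real_setOf_subset (zdGraph 3) 1 (column n) (column_subset_edgeSet n)
  rw [Set.Icc.coe_one, one_pow] at h
  calc (1 : ℝ) = (Pp 1).real {ω | ↑(column n) ⊆ ω} := by rw [Pp, h]
    _ ≤ _ := measureReal_mono fun ω hω =>
        ((reachable_up_of_column hω le_rfl).mono inf_le_left : (openGraph ω).Reachable 0 (up n))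

/-- **The conclusion FAILS at `p = 1`**: `τ_1(0, n e₀) ≡ 1 ↛ 0`. -/
theorem not_axisDecayAt_one : ¬ AxisDecayAt 1 := by
  intro h
  have h1 : Tendsto (fun _ : ℕ => (1 : ℝ)) atTop (𝓝 0) := by
    refine h.congr fun n => ?_
    exact real_openConn_axis_one n
  have h01 := tendsto_nhds_unique h1 tendsto_const_nhds
  norm_num at h01

/-- At `p = 1`, `π_1(r) = 1` for every `r`. -/
theorem armProb_one (r : ℕ) : armProb 1 r = 1 := by
  apply le_antisymm (measureReal_le_one)
  have h := bondPercolation_real_setOf_subset (zdGraph 3) 1 (column r) (column_subset_edgeSet r)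
  rw [Set.Icc.coe_one, one_pow] at h
  calc (1 : ℝ) = (Pp 1).real {ω | ↑(column r) ⊆ ω} := by rw [Pp, h]
    _ ≤ armProb 1 r := measureReal_mono (setOf_column_subset_arm r)

/-- **C FAILS at `p = 1`**: `π_1 ≡ 1` is not `O(r^{-a})` for any `a > 0`. -/
theorem not_armDecayAt_one : ¬ ArmDecayAt 1 := by
  rintro ⟨a, C, ha, h⟩
  refine not_forall_rpow_le (c := 1) (C := C) (s := -a) (t := 0) one_pos (by linarith) fun r hr => ?_
  have := h r hr
  rw [armProb_one] at this
  simpa [Real.rpow_zero] using this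

/-- `BookkeepingAt 1` holds, VACUOUSLY (through ¬B — landed `tallClusterMassBound_false_without_criticality :
¬ MassBoundAt 1 (11/4)` — or through ¬C). -/
theorem bookkeepingAt_one : BookkeepingAt 1 := fun _ hB _ =>
  absurd hB tallClusterMassBound_false_without_criticality

/-- K with BOTH B and C dropped, at parameter `p`. -/
def BookkeepingWithoutBC (p : unitInterval) : Prop := TwoArmAt p → AxisDecayAt p

/-- **LOAD-BEARING (family level): B or C must be used.**  `A → conclusion` is false at `p = 1`, so no proof of
K can consume only hypothesis A by an argument insensitive to `p` (A is "free" wherever the two roots are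
typically joined; the saturation count `a₂ = 3` says the same at `p_c` heuristically). -/
theorem bookkeeping_false_without_BC : ¬ BookkeepingWithoutBC 1 :=
  fun h => not_axisDecayAt_one (h twoArmAt_one)

/-- The family statement "A suffices at every `p`" is false. -/
theorem not_forall_twoArm_imp_axisDecay : ¬ ∀ p : unitInterval, TwoArmAt p → AxisDecayAt p :=
  fun h => bookkeeping_false_without_BC (h 1)

/-! ### §2b The other endpoint `p = 0`: all three hypotheses AND the conclusion hold (non-vacuously)

So the family `BookkeepingAt p` is non-degenerate: at `p = 0` A, B, C and the conclusion are all true, at `p = 1`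
A is true and B, C, conclusion are all false.  (Joint satisfiability of the SHAPES of A, B, C; at `p_c` itself
joint satisfiability is believed but not provable today.) -/

/-- `P_0` is the point mass at the empty configuration. -/
theorem Pp_zero : Pp 0 = Measure.dirac (∅ : BondConfig V3) := by
  unfold Pp bondPercolation
  exact setBernoulli_zero _

/-- In the empty configuration nothing but `0` is reachable from `0`. -/
theorem reachable_empty_iff {x y : V3} : (openGraph (∅ : BondConfig V3)).Reachable x y ↔ x = y := by
  have h : openGraph (∅ : BondConfig V3) = ⊥ := by
    ext u v
    simp [openGraph_adj]
  rw [h, SimpleGraph.reachable_bot]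

/-- The empty configuration has no arm: `∅ ∉ arm r` for `r ≥ 1`. -/
theorem empty_not_mem_arm {r : ℕ} (hr : 1 ≤ r) : (∅ : BondConfig V3) ∉ arm r := by
  intro h
  obtain ⟨y, hy, hreach⟩ := mem_arm_iff.1 h
  have h0y : (0 : V3) = y := reachable_empty_iff.1 (hreach.mono inf_le_left)
  subst h0y
  have : snorm (0 : V3) = 0 := by simp [snorm]
  omega

/-- `π_0(r) = 0` for `r ≥ 1`. -/
theorem armProb_zero {r : ℕ} (hr : 1 ≤ r) : armProb 0 r = 0 := by
  unfold armProb
  rw [measureReal_def, Pp_zero, Measure.dirac_apply' _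
    (measurableSet_arm r)]
  simp [Set.indicator_of_notMem, empty_not_mem_arm hr]

/-- A holds at `p = 0` (the event needs an arm from `0`). -/
theorem twoArmAt_zero : TwoArmAt 0 := by
  refine ⟨1, 0, one_pos, fun r hr => ?_⟩
  rw [zero_mul]
  have hsub : E r ⊆ arm r := fun ω hω => hω.1
  calc (Pp 0).real (E r) ≤ (Pp 0).real (arm r) := measureReal_mono hsub
    _ = 0 := armProb_zero hr

/-- B holds at `p = 0` (both sides vanish). -/
theorem massBoundAt_zero (s : ℝ) : MassBoundAt 0 s := by
  refine ⟨0, fun r hr => ?_⟩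
  have hm : mass 0 r ≤ 0 := by
    unfold mass
    refine Finset.sum_nonpos fun x _ => ?_
    calc (Pp 0).real (conn x ∩ arm r) ≤ (Pp 0).real (arm r) := measureReal_mono Set.inter_subset_right
      _ = 0 := armProb_zero hr
  rw [zero_mul, zero_mul]
  exact hm

/-- C holds at `p = 0`. -/
theorem armDecayAt_zero : ArmDecayAt 0 :=
  ⟨1, 0, one_pos, fun r hr => by rw [armProb_zero hr, zero_mul]⟩

/-- The conclusion holds at `p = 0` (`τ_0(0, n e₀) = 0` for `n ≥ 1`). -/
theorem axisDecayAt_zero : AxisDecayAt 0 := by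
  apply tendsto_atTop_of_eventually_const (i₀ := 1)
  intro n hn
  rw [measureReal_def, Pp_zero, Measure.dirac_apply' _ (measurableSet_openConn_holds _ _)]
  have hne : (0 : V3) ≠ (Pi.single 0 (n : ℤ) : V3) := by
    intro h
    have h0 := congrFun h 0
    simp at h0
    omega
  have : (∅ : BondConfig V3) ∉ openConn (0 : V3) (Pi.single 0 (n : ℤ) : V3) := fun h =>
    hne (reachable_empty_iff.1 h)
  simp [Set.indicator_of_notMem, this]

/-- `BookkeepingAt 0` holds with all three hypotheses true (non-vacuously). -/
theorem bookkeepingAt_zero : BookkeepingAt 0 := fun _ _ _ => axisDecayAt_zero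

/-! ## §3 Natural strengthenings / proposed stubs refuted AS TYPED

The statements below are copied verbatim (modulo the local abbreviations `μc`, `HS`) from the crux idea
sketches `Cruxes/LowPointBookkeeping/SketchIdeator2.lean` (namespace `…Ideas2`) and
`SketchIdeator1.lean` (namespace `…SketchK1`); each refutation names the degenerate instance and the repair. -/

open scoped Classical

/-- The critical measure (as in the sketches). -/
abbrev μc : Measure (BondConfig (Site 3)) := bondPercolation (zdGraph 3) (criticalProbI 3)

/-- `ℍ = {x₀ ≥ 0}` (as in the sketches). -/
abbrev HS : Set (Site 3) := {x : Site 3 | 0 ≤ x 0}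

/-- **B♯ `NoFatHalfBox`** (card holder-tightness-decoupling; `Ideas2.NoFatHalfBox` verbatim): with probability
`≥ ε` no half-space cluster has `≥ r^{11/4+δ}` vertices in `B_r ∩ ℍ`, uniformly in `r ≥ 1`. -/
def NoFatHalfBox : Prop :=
  ∃ ε δ : ℝ, 0 < ε ∧ 0 ≤ δ ∧ ∀ r : ℕ, 1 ≤ r →
    μc.real {ω | ∃ v : Site 3, 0 ≤ v 0 ∧
      (r : ℝ) ^ ((11 : ℝ) / 4 + δ) ≤ (((box 3 r).filter fun x => ω ∈ openConnIn HS v x).card : ℝ)}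
      ≤ 1 - ε

/-- `0 ↔_ℍ 0` always. -/
theorem mem_openConnIn_zero_zero (ω : BondConfig (Site 3)) : ω ∈ openConnIn HS (0 : Site 3) 0 := by
  have : ω ∈ conn 0 := by rw [conn_zero]; trivial
  exact this

/-- **`NoFatHalfBox` is FALSE as typed** (degenerate scale `r = 1`: the cluster of `v = 0` always has
`≥ 1 = 1^{11/4+δ}` vertex in `B_1`, so the "fat cluster" event is sure and `1 ≤ 1 - ε` fails).  Repair C′:
threshold `C · r^{11/4+δ}` with a constant `C > 27 = |B_1|` (or `∀ r ≥ r₀` with `r₀ ≥ 2`); the witness misses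
C′ — misstated, not substantive. -/
theorem not_noFatHalfBox : ¬ NoFatHalfBox := by
  rintro ⟨ε, δ, hε, -, h⟩
  have h1 := h 1 le_rfl
  have hset : {ω : BondConfig (Site 3) | ∃ v : Site 3, 0 ≤ v 0 ∧
      ((1 : ℕ) : ℝ) ^ ((11 : ℝ) / 4 + δ) ≤
        (((box 3 1).filter fun x => ω ∈ openConnIn HS v x).card : ℝ)} = Set.univ := by
    refine Set.eq_univ_of_forall fun ω => ⟨0, le_rfl, ?_⟩
    rw [Nat.cast_one, Real.one_rpow]
    have hmem : (0 : Site 3) ∈ (box 3 1).filter fun x => ω ∈ openConnIn HS (0 : Site 3) x := by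
      rw [Finset.mem_filter]
      exact ⟨by simp [mem_box], mem_openConnIn_zero_zero ω⟩
    exact_mod_cast Finset.card_pos.2 ⟨0, hmem⟩
  rw [hset, probReal_univ] at h1
  linarith

/-- **B♯ for all windows `NoFatHalfBoxWindows`** (`Ideas2.NoFatHalfBoxWindows` verbatim). -/
def NoFatHalfBoxWindows : Prop :=
  ∃ ε δ : ℝ, 0 < ε ∧ 0 ≤ δ ∧ ∀ L : ℕ, 1 ≤ L → ∀ z : Site 3, 0 ≤ z 0 →
    μc.real {ω | ∃ v : Site 3, 0 ≤ v 0 ∧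
      (L : ℝ) ^ ((11 : ℝ) / 4 + δ) ≤
        (((box 3 L).filter fun x => ω ∈ openConnIn HS v (z + x)).card : ℝ)} ≤ 1 - ε

/-- **`NoFatHalfBoxWindows` is FALSE as typed** (window `L = 1` at `z = 0`, cluster of `v = 0`).  Same repair. -/
theorem not_noFatHalfBoxWindows : ¬ NoFatHalfBoxWindows := by
  rintro ⟨ε, δ, hε, -, h⟩
  have h1 := h 1 le_rfl 0 le_rfl
  have hset : {ω : BondConfig (Site 3) | ∃ v : Site 3, 0 ≤ v 0 ∧
      ((1 : ℕ) : ℝ) ^ ((11 : ℝ) / 4 + δ) ≤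
        (((box 3 1).filter fun x => ω ∈ openConnIn HS v ((0 : Site 3) + x)).card : ℝ)} = Set.univ := by
    refine Set.eq_univ_of_forall fun ω => ⟨0, le_rfl, ?_⟩
    rw [Nat.cast_one, Real.one_rpow]
    have hmem : (0 : Site 3) ∈ (box 3 1).filter fun x => ω ∈ openConnIn HS (0 : Site 3) ((0 : Site 3) + x) := by
      rw [Finset.mem_filter, add_zero]
      exact ⟨by simp [mem_box], mem_openConnIn_zero_zero ω⟩
    exact_mod_cast Finset.card_pos.2 ⟨0, hmem⟩
  rw [hset, probReal_univ] at h1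
  linarith

/-! ### Card floor-density-russo-pair-overlap, endpoint `s = 0` (`SketchK1.floorDilute_empty_mem_openConnIn_iff`) -/

/-- The upper part `ℍ₊ = {x₀ ≥ 1}` (as in the sketch). -/
abbrev Hp : Set (Site 3) := {x : Site 3 | 1 ≤ x 0}

/-- FLOOR EDGES as in the sketch: ALL unordered pairs of floor points (lattice or not). -/
def floorEdges : Set (Sym2 (Site 3)) :=
  {f | ∃ x y : Site 3, f = s(x, y) ∧ x 0 = 0 ∧ y 0 = 0}

/-- Floor dilution as in the sketch. -/
def floorDilute (ω ξ : BondConfig (Site 3)) : BondConfig (Site 3) := ω \ (floorEdges \ ξ)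

/-- The sketch's endpoint statement, as a `Prop` (verbatim signature, universally closed). -/
def FloorDiluteEmptyIff : Prop :=
  ∀ (ω : BondConfig (Site 3)) (a b : Site 3), 1 ≤ a 0 → 1 ≤ b 0 →
    (floorDilute ω ∅ ∈ openConnIn HS a b ↔ ω ∈ openConnIn Hp a b)

private abbrev pa : Site 3 := ![1, 0, 0]
private abbrev pb : Site 3 := ![1, 2, 0]
private abbrev pf : Site 3 := ![0, 1, 0]

/-- The witness configuration: two NON-lattice bonds `a — f — b` through the floor point `f`. -/
private def ωbad : BondConfig (Site 3) := {s(pa, pf), s(pf, pb)}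

private theorem pa_ne_pf : pa ≠ pf := by decide
private theorem pf_ne_pb : pf ≠ pb := by decide
private theorem pa_ne_pb : pa ≠ pb := by decide

private theorem mem_floorDilute_of_mem {g : Sym2 (Site 3)} (hg : g ∈ ωbad)
    (hnf : g ∉ floorEdges) : g ∈ floorDilute ωbad ∅ :=
  ⟨hg, fun h => hnf h.1⟩

private theorem saf_not_floor : s(pa, pf) ∉ floorEdges := by
  rintro ⟨x, y, hxy, hx, hy⟩
  rcases Sym2.eq_iff.1 hxy with ⟨rfl, -⟩ | ⟨rfl, -⟩
  · exact absurd hx (by decide)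
  · exact absurd hy (by decide)

private theorem sfb_not_floor : s(pf, pb) ∉ floorEdges := by
  rintro ⟨x, y, hxy, hx, hy⟩
  rcases Sym2.eq_iff.1 hxy with ⟨-, rfl⟩ | ⟨-, rfl⟩
  · exact absurd hy (by decide)
  · exact absurd hx (by decide)

/-- **The endpoint lemma `s = 0` is FALSE as typed**: for the configuration `ωbad = {s(a,f), s(f,b)}` with
`a = (1,0,0)`, `b = (1,2,0)` in `ℍ₊` and the floor point `f = (0,1,0)`, the diluted configuration still joins
`a` to `b` inside `ℍ` (neither bond is a floor edge), but `a ↮ b` inside `ℍ₊` (every bond of `ωbad` touches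
`f ∉ ℍ₊`).  The bonds are not lattice edges: the statement is true for `ω ⊆ (zdGraph 3).edgeSet` (a floor
vertex then has the single non-floor neighbour `f + e₀` in `ℍ`), which holds `P_p`-a.s.  Repair C′: add the
hypothesis `ω ⊆ (zdGraph 3).edgeSet` (as in the landed `LowPoint.exists_wall_exit`); misstated, not substantive. -/
theorem floorDilute_empty_iff_false_without_lattice : ¬ FloorDiluteEmptyIff := by
  intro h
  have hiff := h ωbad pa pb (by decide) (by decide)
  -- left side holds: a — f — b inside ℍ through the two surviving (non-floor) bonds
  have hL : floorDilute ωbad ∅ ∈ openConnIn HS pa pb := by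
    refine ⟨by decide, by decide, ?_⟩
    have h1 : ((openGraph (floorDilute ωbad ∅)).induce HS).Adj ⟨pa, by decide⟩ ⟨pf, by decide⟩ := by
      show (openGraph (floorDilute ωbad ∅)).Adj pa pf
      rw [openGraph_adj]
      exact ⟨mem_floorDilute_of_mem (by simp [ωbad]) saf_not_floor, pa_ne_pf⟩
    have h2 : ((openGraph (floorDilute ωbad ∅)).induce HS).Adj ⟨pf, by decide⟩ ⟨pb, by decide⟩ := by
      show (openGraph (floorDilute ωbad ∅)).Adj pf pb
      rw [openGraph_adj]
      exact ⟨mem_floorDilute_of_mem (by simp [ωbad]) sfb_not_floor, pf_ne_pb⟩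
    exact h1.reachable.trans h2.reachable
  obtain ⟨ha, hb, hreach⟩ := hiff.1 hL
  -- right side fails: inside ℍ₊ the configuration `ωbad` has no open bond (each bond contains `f ∉ ℍ₊`)
  have hfHp : pf ∉ Hp := by decide
  have key : ∀ u v : Hp, ¬ ((openGraph ωbad).induce Hp).Adj u v := by
    intro u v huv
    have huv' : (openGraph ωbad).Adj u.1 v.1 := huv
    rw [openGraph_adj] at huv'
    obtain ⟨hmem, -⟩ := huv'
    simp only [ωbad, Set.mem_insert_iff, Set.mem_singleton_iff] at hmem
    rcases hmem with h1 | h1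
    · rcases Sym2.eq_iff.1 h1 with ⟨-, h2⟩ | ⟨h2, -⟩
      · exact hfHp (h2 ▸ v.2)
      · exact hfHp (h2 ▸ u.2)
    · rcases Sym2.eq_iff.1 h1 with ⟨h2, -⟩ | ⟨-, h2⟩
      · exact hfHp (h2 ▸ u.2)
      · exact hfHp (h2 ▸ v.2)
  have hbot : (openGraph ωbad).induce Hp = ⊥ := by
    ext u v
    exact ⟨fun huv => (key u v huv).elim, fun huv => ((SimpleGraph.bot_adj _ _).1 huv).elim⟩
  rw [hbot] at hreach
  exact pa_ne_pb (Subtype.ext_iff.1 (SimpleGraph.reachable_bot.1 hreach))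

/-! ## §4 Exponent ledger of the intended mechanism (real analysis only)

The card's dyadic count bounds the cross-bush term by `C Σ_k 2^{k(2m-3-a₂)}` from B (`m`) and A (`a₂`).
The two lemmas below record the bookkeeping threshold exactly: with the typed `m = 11/4` the series
converges iff `a₂ > 5/2`, i.e. iff A's `κ > 0`; there is no slack beyond `κ` (Findings-ideator1 §1). -/

/-- The dyadic bookkeeping series `k ↦ 2^{k(2m-3-a₂)}`. -/
def bookkeepingSeries (m a₂ : ℝ) (k : ℕ) : ℝ := ((2 : ℝ) ^ (2 * m - 3 - a₂)) ^ k

/-- The series converges iff `a₂ > 2m - 3`. -/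
theorem bookkeepingSeries_summable_iff (m a₂ : ℝ) :
    Summable (bookkeepingSeries m a₂) ↔ 2 * m - 3 < a₂ := by
  unfold bookkeepingSeries
  rw [summable_geometric_iff_norm_lt_one, Real.norm_eq_abs,
    abs_of_pos (Real.rpow_pos_of_pos two_pos _), ← Real.rpow_zero (2 : ℝ),
    Real.rpow_lt_rpow_left_iff one_lt_two]
  constructor <;> intro h <;> linarith

/-- At the TYPED exponents (`m = 11/4` from B, `a₂ = 5/2 + κ` from A) the series converges iff `κ > 0`:
the mechanism's entire margin is A's `κ`. -/
theorem bookkeepingSeries_typed_summable_iff (κ : ℝ) :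
    Summable (bookkeepingSeries (11 / 4) (5 / 2 + κ)) ↔ 0 < κ := by
  rw [bookkeepingSeries_summable_iff]
  constructor <;> intro h <;> linarith

/-- TIGHT AT `κ = 0`: with A at the bare exponent `5/2` the dyadic bookkeeping diverges. -/
theorem not_summable_bookkeepingSeries_kappa_zero :
    ¬ Summable (bookkeepingSeries (11 / 4) (5 / 2)) := by
  rw [bookkeepingSeries_summable_iff]
  norm_num

/-- Conversely, with the saturation value `a₂ = 3` (forced heuristically, measured 2.9–3.1) the series
tolerates any mass exponent `m < 3`: the bookkeeping then needs B only in the form `m < 3`, i.e. exactly the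
one-cluster statement a jump world violates (`not_massBoundAt_of_dense`). -/
theorem bookkeepingSeries_saturated_summable_iff (m : ℝ) :
    Summable (bookkeepingSeries m 3) ↔ m < 3 := by
  rw [bookkeepingSeries_summable_iff]
  constructor <;> intro h <;> linarith

/-! ## §5 Census of attacks on the remaining sketched stubs (no kill) — why each resists

Checked on paper against the definitions actually used (`openConnIn` = induced reachability, `box`,
`Set.ncard`, `Measure.map`, lower `lintegral`, `iSup` in `ℕ`), 2026-08-16, cycle 1:

* `SketchK1.crossTerm_le_integral_pairOverlap` — TRUE as an inequality: Russo in the floor density `σ` gives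
  `S(n) = ∫₀^{p_c} Σ_f P_σ(D_f)/(1-σ) dσ ≤ (p_c/(1-p_c)) ∫₀¹ 𝔇_{s p_c} ds` and `p_c/(1-p_c) < 1` by
  `FloorSubcritical`; both orientations of each floor edge are covered by the sum over the four neighbours
  `e`; the dilution map `(ω, ξ) ↦ ω ∖ (floorEdges ∖ ξ)` IS measurable (coordinatewise finite dependence),
  so `Measure.map` is not junk; `n = 0` gives `0 ≤ …`.
* `SketchK1.tall_succ_ge` — TRUE for every `r` (including `r = 0`): condition on the cluster of `0` inside
  `B_r ∩ ℍ`, open one unrevealed outward edge at a vertex of sup-norm `r`.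
* `SketchK1.tallMass_floorDiluted_le`, `lintegral_inter_le_mul_add_tail`, `pairCount_le_mass_mul_localMax`
  (`⨆` over `ℕ` is fine: the range is bounded by `Z.ncard`), `Ideas2.HolderTwoBushStatement` (Hölder with
  `(k/(k-1), 2k, 2k)`) — TRUE.
* `SketchK1.MassTail`, `LocalMassTail`, `decorated_le_of_massTail`; `Ideas2.TallMassMoments`,
  `PointwiseWallTwoPoint`, `BoundaryTwoArmPoly`, `BoundaryTwoArmSharp`, `DisjointnessDoesNotFatten` (AB),
  `ArmConditionedBHK` (AB₂) — IRREFUTABLE with present tools: every refutation needs a polynomial LOWER bound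
  on a disjoint boundary two-arm event or on a far-point density / mass TAIL at `p_c(ℤ³)`; forcing a dense
  cluster costs `p_c^{c r^{11/4}}`, forcing disjointness costs a closed surface `(1-p_c)^{c r²}`, and the only
  rigorous one-cluster floors are `π_s(r) ≥ 1/(588 r²)`, `τ_ℍ(0, 2h e₀) ≥ 1/(588² h⁴)`, `M(r) ≥ (r+1) π_s(r)`
  (landed).  Small-parameter corners are absorbed by the constants EXCEPT in (AB), which is genuinely
  asymptotic in `h` (`E[massIn h; twoArm h N] ≤ (2h+1)³ P` forces `C ≥ 27 h^{1/4}` if used trivially) — its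
  content is exactly "disjointness does not fatten", MC ratio 0.686 flat (kit j015398).
* `Ideas2.WindowAverageDecay` — equivalent to the conjunct (proved direction in the sketch; converse by
  `tendsto_tau_cofinite_of_theta_eq_zero`), hence irrefutable like K.
* Prover 14687-0's rooted two-bush sum `R(n) = Σ_v P({0,e₀} open, e₀ ↔ v in ℍ₁, 0 ↔ v+ne₀ in ℍ, e₀ ↮ v+ne₀ in ℍ₁)`
  (landed `tendsto_crossPinned_of_tendsto_rooted`): heuristic count Region I `n^{m-3-x_s} Σ_{ρ<n} ρ^{m+x_s-a₂}`,
  Region II `Σ_{ρ>n} ρ^{2m-3-a₂}`; real-world exponents (`m = 2.52`, `x_s = 0.975`, `a₂ = 3`) give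
  `R(n) ≈ n^{-0.95} → 0`, typed exponents give `n^{-κ}`: consistent, no kill; `R(n) ↛ 0` would need `θ > 0`-type
  input.
* K's hypotheses jointly: no contradiction derivable from landed floors (`B ∧ C ⇒ χ_ℍ^{(r)} ≤ C r^{11/4}` vs the
  rigorous `χ_ℍ^{(r)} ≳ r`; A has no rigorous lower bound at all), so K is not vacuous as far as anyone can show.
-/

end Summit.CriticalPhenomena.PercolationContinuityZ3.Cruxes.LowPointBookkeeping.Disproof

end
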